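import Summits.CriticalPhenomena.PercolationContinuityZ3.Theorems.Transplant.TwoAxisExitFrame
import Summits.CriticalPhenomena.PercolationContinuityZ3.Theorems.Transplant.SkelPhiQStepsN
import HarnessLib

/-!
# Quasi-step rung (N3-b), LEVEL 1, row α4 of WAVE-Q-MANIFEST under (ι) := `Skelφ.QStepsN G φ M` (design owner p3-g29 / refuter p5-g28 F2, 2026-08-27): THE EXIT FRAMES
# HAVE QUASI-STEPS OF COST `3M` when the chart `φ` has exact-footprint quasi-steps of cost `M` — `Skelφ.QStepsN G (exitFrame φ t I b cα cβ U s) (3M)` under the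
# hypotheses of «TwoAxisExitFrame» §5 (`|c_b| ≤ |c_a|`, `0 < |c_a|`, `|cα| + |cβ| ≤ U ≤ 3|c_a|`); the `×M` twin of `Skelφ.qSteps_exitFrame` (which assumed `Steps G φ`
# and produced `Link3`s)

builds on p205010 (kernel theorem, internal audit signed; external expert review pending) — nothing in this file uses p205010; nothing here is a claim about any open node; no carrier,
no node, no definition.  Lane `prim-bschramm`, seat `prim-bschramm-gen-1` (gen 4; GEN pen).  Helper file (`--supports stmt-CriticalPhenomena-4575 --as helper`).
WHY (HOME/WAVE-Q-MANIFEST.md v0.3 §3 row α4).  «TwoAxisExitFrame» §5 realises each unit move of the exit frame by one, two or three SINGLE φ-steps whose intermediate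
vertices keep the frame value (`Link3`).  Under the exact footprint each φ-step becomes a φ-LINK of cost `M` whose inner vertices carry the start's φ-value — hence
the start's FRAME value (`exitFrame_congr`: the exit frame is a function of `φ`) — and links through intermediate vertices of the SAME frame value concatenate into ONE
frame-link (`LinkN.trans_of_eq`).  The level arithmetic (`TwoAxis.Para.level_tangential/level_inward`) and the frame-update lemmas `exitFrame_of_step_raw/inward/inward'`
are REUSED verbatim.  Consumers («TwoAxisParaCellsFine» `qSteps_uFrame/vFrame` → `qStepsN_of_qSteps` in «SkelPhiFaceKitsGFC»/«SkelPhiForcedFaceKitClauseC») read the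
`QStepsN … (3M)` form directly.  Regression: at `M = 1` (`qStepsN_of_steps`) a `LinkN … 3` is what `qStepsN_of_qSteps` made of the tree's `Link3`.
* §1 `exitFrame_congr`, `linkN_exitFrame_of_linkN`, `LinkN.trans_of_eq`;
* §2 **`exitFrame_tangential_q`**, **`exitFrame_inward_q`**, **`qStepsN_exitFrame_of_qStepsN`**.
[cite: KozmaNitzan2024, §4 Lemma 10 Step III (p. 19)] [cite: MartineauTassion2017, §4.3]
-/

noncomputable section

open scoped Classical

namespace Summit.CriticalPhenomena.PercolationContinuityZ3.Theorems.Transplant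

namespace Skelφ

open Literature.Probability.LatticeModels SimpleGraph
open Literature.Probability.Percolation.KozmaNitzan.Cells (oth oth_ne eq_oth_of_ne oth_oth)
open TwoAxis.Para (coarse)

variable {V : Type} {G : SimpleGraph V} {φ : V → Site 2} {M : ℕ}

/-! ## §1 Frame links from chart links -/

/-- The exit frame is a function of the chart value. [folklore] -/
theorem exitFrame_congr (t : V) (I b : Fin 2) (cα cβ U s : ℤ) {u v : V} (huv : φ u = φ v) :
    exitFrame φ t I b cα cβ U s u = exitFrame φ t I b cα cβ U s v := by
  have hr : relφ φ t u = relφ φ t v := by funext j; rw [relφ_apply, relφ_apply, huv]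
  funext i
  by_cases hi : i = I
  · subst hi; rw [exitFrame_apply_self, exitFrame_apply_self, hr]
  · rw [eq_oth_of_ne hi, exitFrame_apply_oth, exitFrame_apply_oth, hr]

/-- A φ-link is a frame-link of the same cost (inner vertices at the start's chart value are at the start's frame value). [folklore] -/
theorem linkN_exitFrame_of_linkN (t : V) (I b : Fin 2) (cα cβ U s : ℤ) {v v' : V} (h : LinkN G φ M v v') :
    LinkN G (exitFrame φ t I b cα cβ U s) M v v' := by
  obtain ⟨p, hp, hF⟩ := h
  refine ⟨p, hp, fun u hu => ?_⟩
  rcases hF u hu with e | e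
  · exact Or.inl (exitFrame_congr t I b cα cβ U s e)
  · exact Or.inr e

/-- **Concatenating links through a vertex of the start value**: `w ⇝ m` (cost `N₁`), `F m = F w`, `m ⇝ w′` (cost `N₂`) give `w ⇝ w′` of cost `N₁ + N₂` with the exact
footprint. [folklore] -/
theorem LinkN.trans_of_eq {F : V → Site 2} {N₁ N₂ : ℕ} {w m w' : V} (h₁ : LinkN G F N₁ w m) (hm : F m = F w) (h₂ : LinkN G F N₂ m w') :
    LinkN G F (N₁ + N₂) w w' := by
  obtain ⟨p, hp, hF₁⟩ := h₁
  obtain ⟨q, hq, hF₂⟩ := h₂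
  refine ⟨p.append q, by rw [Walk.length_append]; omega, fun u hu => ?_⟩
  rw [Walk.mem_support_append_iff] at hu
  rcases hu with hu | hu
  · rcases hF₁ u hu with e | rfl
    · exact Or.inl e
    · exact Or.inl hm
  · rcases hF₂ u hu with e | e
    · exact Or.inl (e.trans hm)
    · exact Or.inr e

/-! ## §2 The quasi-steps of the exit frame from quasi-steps of the chart -/

section Moves

variable (t : V) {I b : Fin 2} {cα cβ U s : ℤ}
variable (hq : QStepsN G φ M) (hU : 0 < U) (hsum : |cα| + |cβ| ≤ U)
include hq hU hsum

/-- **TANGENTIAL QUASI-STEP** (chart with quasi-steps of cost `M`): the raw coordinate moves by `τ = ±1` at fixed level through a frame-link of cost `≤ 3M` (one `e_b`-link,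
possibly after one corrective `e_a`-link), provided `|c_b| ≤ |c_a|` (`a = oth b`). [this work] -/
theorem exitFrame_tangential_q (hab : |coef cα cβ b| ≤ |coef cα cβ (oth b)|) (w : V) (τ : ℤˣ) :
    ∃ w', exitFrame φ t I b cα cβ U s w' = exitFrame φ t I b cα cβ U s w + Pi.single (oth I) (τ : ℤ) ∧
      LinkN G (exitFrame φ t I b cα cβ U s) (3 * M) w w' := by
  set L := linForm cα cβ (relφ φ t w) with hL
  have hsum' : |coef cα cβ (oth b)| + |coef cα cβ b| ≤ U := by rw [add_comm, abs_coef_add]; exact hsum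
  have hd : (τ : ℤ) * coef cα cβ b = coef cα cβ b ∨ (τ : ℤ) * coef cα cβ b = -coef cα cβ b := by
    rcases Int.units_eq_one_or τ with h | h <;> simp [h]
  rcases TwoAxis.Para.level_tangential (s := s) (t := L) hU hab hsum' hd with hsame | ⟨e, he, h1, h2⟩
  · obtain ⟨w', hφ, hl⟩ := hq w b τ
    exact ⟨w', exitFrame_of_step_raw t hφ hsame, (linkN_exitFrame_of_linkN t I b cα cβ U s hl).mono (by omega)⟩
  · have hσ : ∃ σ : ℤˣ, e = (σ : ℤ) * coef cα cβ (oth b) := by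
      rcases he with rfl | rfl
      · exact ⟨1, by simp⟩
      · exact ⟨-1, by simp⟩
    obtain ⟨σ, rfl⟩ := hσ
    obtain ⟨m, hφ₁, hl₁⟩ := hq w (oth b) σ
    obtain ⟨w', hφ₂, hl₂⟩ := hq m b τ
    have hm : exitFrame φ t I b cα cβ U s m = exitFrame φ t I b cα cβ U s w :=
      exitFrame_of_step_inward t hφ₁ (by rw [add_zero]; exact h1)
    have hLm : linForm cα cβ (relφ φ t m) = L + (σ : ℤ) * coef cα cβ (oth b) := by
      rw [relφ_of_step (t := t) hφ₁, linForm_add_single]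
    refine ⟨w', ?_, ((linkN_exitFrame_of_linkN t I b cα cβ U s hl₁).trans_of_eq hm (linkN_exitFrame_of_linkN t I b cα cβ U s hl₂)).mono (by omega)⟩
    rw [← hm]
    refine exitFrame_of_step_raw t hφ₂ ?_
    rw [hLm, h2, ← hLm]
    have := congrFun hm I
    rw [exitFrame_apply_self, exitFrame_apply_self] at this
    exact this.symm

/-- **INWARD QUASI-STEP** (chart with quasi-steps of cost `M`): the level moves by `σ = ±1` at fixed raw coordinate through a frame-link of cost `≤ 3M` (`≤ 3` links along
`a = oth b`), provided `0 < |c_a|`, `U ≤ 3·|c_a|`. [this work] -/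
theorem exitFrame_inward_q (hca : 0 < |coef cα cβ (oth b)|) (hU3 : U ≤ 3 * |coef cα cβ (oth b)|) (w : V) (σ : ℤˣ) :
    ∃ w', exitFrame φ t I b cα cβ U s w' = exitFrame φ t I b cα cβ U s w + Pi.single I (σ : ℤ) ∧
      LinkN G (exitFrame φ t I b cα cβ U s) (3 * M) w w' := by
  set L := linForm cα cβ (relφ φ t w) with hL
  have haU : |coef cα cβ (oth b)| ≤ U := by
    have := abs_coef_add cα cβ b; have := abs_nonneg (coef cα cβ b); linarith
  have hσ : (σ : ℤ) = 1 ∨ (σ : ℤ) = -1 := by rcases Int.units_eq_one_or σ with h | h <;> simp [h]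
  obtain ⟨e, he, hcases⟩ := TwoAxis.Para.level_inward (s := s) (t := L) hU hca hU3 haU hσ
  have hρ : ∃ ρ : ℤˣ, e = (ρ : ℤ) * coef cα cβ (oth b) := by
    rcases he with rfl | rfl
    · exact ⟨1, by simp⟩
    · exact ⟨-1, by simp⟩
  obtain ⟨ρ, rfl⟩ := hρ
  obtain ⟨m₁, hφ₁, hl₁⟩ := hq w (oth b) ρ
  obtain ⟨m₂, hφ₂, hl₂⟩ := hq m₁ (oth b) ρ
  obtain ⟨m₃, hφ₃, hl₃⟩ := hq m₂ (oth b) ρ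
  have hF₁ := linkN_exitFrame_of_linkN t I b cα cβ U s hl₁
  have hF₂ := linkN_exitFrame_of_linkN t I b cα cβ U s hl₂
  have hF₃ := linkN_exitFrame_of_linkN t I b cα cβ U s hl₃
  have hL₁ : linForm cα cβ (relφ φ t m₁) = L + (ρ : ℤ) * coef cα cβ (oth b) := by
    rw [relφ_of_step (t := t) hφ₁, linForm_add_single]
  have hL₂ : linForm cα cβ (relφ φ t m₂) = L + 2 * ((ρ : ℤ) * coef cα cβ (oth b)) := by
    rw [relφ_of_step (t := t) hφ₂, linForm_add_single, hL₁]; ring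
  have e2 : L + (ρ : ℤ) * coef cα cβ (oth b) + (ρ : ℤ) * coef cα cβ (oth b) = L + 2 * ((ρ : ℤ) * coef cα cβ (oth b)) := by ring
  have e3 : L + 2 * ((ρ : ℤ) * coef cα cβ (oth b)) + (ρ : ℤ) * coef cα cβ (oth b) = L + 3 * ((ρ : ℤ) * coef cα cβ (oth b)) := by ring
  rcases hcases with h1 | ⟨h1, h2⟩ | ⟨h1, h2, h3⟩
  · exact ⟨m₁, exitFrame_of_step_inward' t hφ₁ h1, hF₁.mono (by omega)⟩
  · have hm₁ : exitFrame φ t I b cα cβ U s m₁ = exitFrame φ t I b cα cβ U s w :=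
      exitFrame_of_step_inward t hφ₁ (by rw [add_zero]; exact h1)
    refine ⟨m₂, ?_, (hF₁.trans_of_eq hm₁ hF₂).mono (by omega)⟩
    rw [← hm₁]
    refine exitFrame_of_step_inward' t hφ₂ ?_
    rw [hL₁, e2, h2, ← h1, ← hL₁]
  · have hm₁ : exitFrame φ t I b cα cβ U s m₁ = exitFrame φ t I b cα cβ U s w :=
      exitFrame_of_step_inward t hφ₁ (by rw [add_zero]; exact h1)
    have hm₂ : exitFrame φ t I b cα cβ U s m₂ = exitFrame φ t I b cα cβ U s m₁ := by
      refine exitFrame_of_step_inward t hφ₂ ?_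
      rw [hL₁, e2, h2, add_zero, ← h1, ← hL₁]
    refine ⟨m₃, ?_, ((hF₁.trans_of_eq hm₁ hF₂).trans_of_eq (hm₂.trans hm₁) hF₃).mono (by omega)⟩
    rw [← hm₁, ← hm₂]
    refine exitFrame_of_step_inward' t hφ₃ ?_
    rw [hL₂, e3, h3, ← h2, ← hL₂]

/-- **THE EXIT FRAME HAS QUASI-STEPS OF COST `3M`** (chart with exact-footprint quasi-steps of cost `M`; `|c_b| ≤ |c_a|`, `0 < |c_a|`, `|cα| + |cβ| ≤ U ≤ 3·|c_a|`).
[this work] -/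
theorem qStepsN_exitFrame_of_qStepsN (hab : |coef cα cβ b| ≤ |coef cα cβ (oth b)|) (hca : 0 < |coef cα cβ (oth b)|)
    (hU3 : U ≤ 3 * |coef cα cβ (oth b)|) : QStepsN G (exitFrame φ t I b cα cβ U s) (3 * M) := by
  intro w i σ
  by_cases hi : i = I
  · subst hi; exact exitFrame_inward_q t hq hU hsum hca hU3 w σ
  · rw [eq_oth_of_ne hi]; exact exitFrame_tangential_q t hq hU hsum hab w σ

end Moves

end Skelφ

end Summit.CriticalPhenomena.PercolationContinuityZ3.Theorems.Transplant

end
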